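import Literature.AlgebraicGeometry.Motives.GrassmannianQuotientIsoPullback
import Literature.AlgebraicGeometry.Motives.GrassmannianProjectiveOver
import Literature.AlgebraicGeometry.Motives.GrassmannianUniversalSubbundle
import Literature.AlgebraicGeometry.Modules.VanishingLocusBaseChange
import Literature.AlgebraicGeometry.Modules.VanishingLocusFiniteLocallyFree
import Literature.AlgebraicGeometry.Modules.KernelOfEpiHasRank
import Literature.AlgebraicGeometry.Modules.KernelFiniteLocallyFree
import Literature.AlgebraicGeometry.Modules.DeterminantCocycle
import Literature.AlgebraicGeometry.KTheory.PullbackVectorBundle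
import HarnessLib

/-!
# The projective bundle `P(G)` of a globally generated vector bundle as an incidence subscheme of `X × Gr₁`,
# with its tautological quotient (Hartshorne II Prop. 7.11–7.12; Fulton B.5.5)

Topic `AlgebraicGeometry/Motives`; namespace `Literature.AlgebraicGeometry.Motives.Grassmannian.ProjBundle`. DEFINITIONS
with bodies (`pullbackFreeIso`, `incidence`, `total`, `totalι`, `proj`, `toGr`, `lineBundle`, `lineQuotπ`) and theorems;
no instance, no notation, no named fact, no `sorry`.

For a scheme `X`, a finite free `ℤ`-module `M` with basis `b : J → M` (`J` finite) and an EPIMORPHISM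
`φ : 𝒪_X^{(J)} ↠ G` of `𝒪_X`-modules («`G` is globally generated by the `φ(ε_j)`»), Hartshorne II Prop. 7.12 realises
`𝐏(G)` as the closed subscheme of `𝐏(𝒪_X^{(J)}) = X × ℙ(J)` of the rank-one quotients of `𝒪^{(J)}` that factor through
`G`. With the tree's Grassmannian `Gr = grassmannianScheme M 1` of RANK-ONE QUOTIENTS of `𝒪 ⊗ M` and its universal
quotient `π : 𝒪_{Gr}^{(J)} ↠ 𝒬` (`Motives/GrassmannianUniversalChartData`, [GortzWedhorn2020, (8.4)]) this is the
VANISHING LOCUS ([Fulton1998, B.3.4], `Modules/VanishingLocusOfHom`) of the incidence morphism on `X × Gr`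

  `u_φ : pr₁^*(ker φ) ⟶ pr₁^* 𝒪_X^{(J)} ≅ 𝒪^{(J)} ≅ pr₂^* 𝒪_{Gr}^{(J)} ⟶ pr₂^* 𝒬`.

* §1 `pullbackFreeIso f I : f^*𝒪^I ≅ 𝒪^I` (Mathlib `SheafOfModules.pullbackObjFreeIso`, the functor `f⁻¹` on opens being
  final, `KTheory/PullbackVectorBundle.final_opensMap`); `incidence`; **`total φ := V(u_φ)`** with the closed immersion
  `totalι : total ⟶ X ⨯ Gr`, `proj := totalι ≫ pr₁ : total ⟶ X`, `toGr := totalι ≫ pr₂`;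
* §2 projectivity: `isProjective_proj` — `proj` is H-projective (`Gr_X → X` is, `Motives/GrassmannianProjectiveOver`, and
  closed immersions compose, `Morphisms/ProjectiveMorphism`), hence proper;
* §3 the tautological quotient: `lineBundle := toGr^*𝒬` (`hasRank_lineBundle : HasRank _ 1`), the epimorphism
  `lineQuotπ : 𝒪_P^{(J)} ↠ lineBundle` and THE INCIDENCE RELATION `pullback_kernel_comp_eq_zero`:
  `proj^*(ker φ ↪ 𝒪^{(J)})` dies in `lineBundle` (`u_φ` dies on `V(u_φ)`, `Modules/VanishingLocusOfHom.pullback_subschemeι_map_eq_zero`);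
  hence (right exactness of `proj^*`, `G = coker(ker φ ↪ 𝒪^{(J)})`) **`exists_epi_tautQuot`**: an EPIMORPHISM
  `λ : proj^*G ↠ lineBundle` with `proj^*φ ≫ λ = (frame) ≫ lineQuotπ`, and **`exists_shortExact_of_hasRank`**: for `G` of rank
  `r + 1` the tautological short exact sequence `0 → K → proj^*G → L → 0` with `HasRank K r`, `HasRank L 1`
  (`Modules/KernelOfEpiHasRank.hasRank_kernel_of_epi`).

NOT here (the sequel): the local triviality `proj⁻¹U ≅ U × Gr₁(ℤ^{r+1})` over a trivialising open of `G` and its consequences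
(smooth of relative dimension `r`, surjective, geometrically irreducible) — together with this file they discharge the named
fact `HodgeTheory.ProjectiveBundleOfGloballyGeneratedQuotient`. Nothing here is about any case of the Hodge conjecture.

## References
* [Hartshorne1977] R. Hartshorne, *Algebraic Geometry* (1977), II §7 Prop. 7.11, Prop. 7.12 (p. 162–163); II §5 p. 110.
* [Fulton1998] W. Fulton, *Intersection Theory*, 2nd ed. (1998), App. B.3.4, B.5.5 (tautological sequence on `P(E)`).
* [GortzWedhorn2020] U. Görtz, T. Wedhorn, *Algebraic Geometry I*, 2nd ed. (2020), (8.4) (pp. 213–215), (13.8) (`ℙ(ℰ)`).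
* [StacksProject] The Stacks Project, Tag 01CD, Tag 089R.
-/

noncomputable section

open CategoryTheory CategoryTheory.Limits Opposite TopologicalSpace AlgebraicGeometry
open Literature.AlgebraicGeometry.Modules Literature.AlgebraicGeometry.Morphisms

universe u

namespace Literature.AlgebraicGeometry.Motives.Grassmannian

namespace ProjBundle

/-! ## §1 The incidence subscheme `P(G) = V(u_φ) ↪ X × Gr₁` -/

section Construction

/-- **`f^* 𝒪_S^{(I)} ≅ 𝒪_T^{(I)}`**, the canonical identification of the pull-back of a free module with the free module
(Mathlib `SheafOfModules.pullbackObjFreeIso`; the functor `f⁻¹` on opens is final, ★ `KTheory.final_opensMap`).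
[cite: Hartshorne1977, II §5 p. 110] -/
def pullbackFreeIso {T S : Scheme.{u}} (f : T ⟶ S) (I : Type u) :
    (Scheme.Modules.pullback f).obj (freeModule S I) ≅ freeModule T I :=
  haveI := KTheory.final_opensMap f
  SheafOfModules.pullbackObjFreeIso f.toRingCatSheafHom I

variable {X : Scheme.{u}} (M : Type u) [AddCommGroup M] {J : Type u} (b : Module.Basis J ℤ M)
  [(grassmannianSheaf M 1).obj.IsRepresentable] {G : X.Modules} (φ : freeModule X J ⟶ G)

/-- **The incidence morphism `u_φ : pr₁^*(ker φ) ⟶ pr₂^* 𝒬` on `X × Gr₁(M)`**: `pr₁^*(ker φ ↪ 𝒪_X^{(J)})` followed by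
`pr₁^*𝒪_X^{(J)} ≅ 𝒪^{(J)} ≅ pr₂^*𝒪_{Gr}^{(J)}` and `pr₂^*` of the universal quotient `π : 𝒪_{Gr}^{(J)} ↠ 𝒬`. Its vanishing
locus is `𝐏(G)`. [cite: Hartshorne1977, II §7 Prop. 7.12] [cite: Fulton1998, B.3.4] -/
def incidence :
    (Scheme.Modules.pullback (prod.fst : X ⨯ grassmannianScheme M 1 ⟶ X)).obj (kernel φ) ⟶
      (Scheme.Modules.pullback (prod.snd : X ⨯ grassmannianScheme M 1 ⟶ grassmannianScheme M 1)).obj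
        (universalQuotient 1 M b) :=
  (Scheme.Modules.pullback prod.fst).map (kernel.ι φ) ≫ (pullbackFreeIso prod.fst J).hom ≫
    (pullbackFreeIso prod.snd J).inv ≫ (Scheme.Modules.pullback prod.snd).map (universalQuotientπ 1 M b)

/-- **`𝐏(G)`, the total space**: the vanishing locus `V(u_φ)` of the incidence morphism, a closed subscheme of
`X × Gr₁(M)`. [cite: Hartshorne1977, II §7 Prop. 7.12] [cite: Fulton1998, B.3.4] -/
abbrev total : Scheme.{u} :=
  (vanishingIdeal (incidence M b φ)).subscheme

/-- The closed immersion `𝐏(G) ↪ X × Gr₁(M)`. [cite: Hartshorne1977, II §7 Prop. 7.12] -/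
abbrev totalι : total M b φ ⟶ X ⨯ grassmannianScheme M 1 :=
  (vanishingIdeal (incidence M b φ)).subschemeι

/-- `𝐏(G) ↪ X × Gr₁(M)` is a closed immersion (Mathlib `IdealSheafData.subschemeι`). [cite: Hartshorne1977, II §7 Prop. 7.12] -/
theorem isClosedImmersion_totalι : IsClosedImmersion (totalι M b φ) :=
  inferInstanceAs (IsClosedImmersion (vanishingIdeal (incidence M b φ)).subschemeι)

/-- **The projection `p : 𝐏(G) ⟶ X`.** [cite: Hartshorne1977, II §7 Prop. 7.11] -/
abbrev proj : total M b φ ⟶ X :=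
  totalι M b φ ≫ prod.fst

/-- The classifying morphism `𝐏(G) ⟶ Gr₁(M)` (second projection). [cite: Hartshorne1977, II §7 Prop. 7.12] -/
abbrev toGr : total M b φ ⟶ grassmannianScheme M 1 :=
  totalι M b φ ≫ prod.snd

/-- `proj = ι ≫ pr₁` (unfolding). [cite: Hartshorne1977, II §7 Prop. 7.11] -/
theorem totalι_fst : totalι M b φ ≫ prod.fst = proj M b φ := rfl

/-- `toGr = ι ≫ pr₂` (unfolding). [cite: Hartshorne1977, II §7 Prop. 7.12] -/
theorem totalι_snd : totalι M b φ ≫ prod.snd = toGr M b φ := rfl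

end Construction

/-! ## §2 `p : 𝐏(G) ⟶ X` is projective -/

section Projective

variable {X : Scheme.{u}} (M : Type u) [AddCommGroup M] [Module.Finite ℤ M] [Module.Free ℤ M] {J : Type u}
  (b : Module.Basis J ℤ M) [(grassmannianSheaf M 1).obj.IsRepresentable]
  [(grassmannianSheaf (⋀[ℤ]^1 M) 1).obj.IsRepresentable] {G : X.Modules} (φ : freeModule X J ⟶ G)

/-- **`p : 𝐏(G) ⟶ X` is H-projective** (a closed immersion into `X × Gr₁(M)`, and `Gr₁(M)_X → X` is H-projective,
★ `isProjective_GrOver_hom`; ★ `IsProjective.comp_isClosedImmersion`). [cite: Hartshorne1977, II §7 Prop. 7.10]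
[cite: GortzWedhorn2020, (8.10) Prop. 8.23 (p. 220)] -/
theorem isProjective_proj : IsProjective (proj M b φ) := by
  haveI := isClosedImmersion_totalι M b φ
  have h : IsProjective (prod.fst : X ⨯ grassmannianScheme M 1 ⟶ X) := by
    rw [← GrOver_hom]
    exact isProjective_GrOver_hom M 1 X
  exact h.comp_isClosedImmersion (totalι M b φ)

/-- `p : 𝐏(G) ⟶ X` is proper. [cite: Hartshorne1977, II §7 Prop. 7.10] -/
theorem isProper_proj : IsProper (proj M b φ) :=
  (isProjective_proj M b φ).isProper

end Projective

/-! ## §3 The tautological quotient `λ : p^*G ↠ L` and the tautological exact sequence -/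

section Tautological

variable {X : Scheme.{u}} (M : Type u) [AddCommGroup M] {J : Type u} (b : Module.Basis J ℤ M)
  [(grassmannianSheaf M 1).obj.IsRepresentable] {G : X.Modules} (φ : freeModule X J ⟶ G)

/-- **The tautological line bundle `L = 𝒪_{𝐏(G)}(1)`**: the pull-back of the universal quotient `𝒬` along
`𝐏(G) ⟶ Gr₁(M)`. [cite: Hartshorne1977, II §7 Prop. 7.11 (b)] [cite: Fulton1998, B.5.5] -/
abbrev lineBundle : (total M b φ).Modules :=
  (Scheme.Modules.pullback (toGr M b φ)).obj (universalQuotient 1 M b)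

/-- `L` has rank one. [cite: Hartshorne1977, II §7 Prop. 7.11 (b)] -/
theorem hasRank_lineBundle : HasRank (lineBundle M b φ) 1 :=
  hasRank_pullback (toGr M b φ) (hasRank_universalQuotient 1 M b)

/-- `L` is finite locally free. [cite: Hartshorne1977, II §7 Prop. 7.11 (b)] -/
theorem isFiniteLocallyFree_lineBundle : IsFiniteLocallyFree (lineBundle M b φ) :=
  HasRank.isFiniteLocallyFree' (hasRank_lineBundle M b φ)

/-- **The quotient map `𝒪_{𝐏(G)}^{(J)} ↠ L`**, pull-back of the universal quotient `π : 𝒪_{Gr}^{(J)} ↠ 𝒬` along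
`𝐏(G) ⟶ Gr₁(M)` (behind `toGr^*𝒪^{(J)} ≅ 𝒪^{(J)}`). [cite: Hartshorne1977, II §7 Prop. 7.11 (b)] [cite: GortzWedhorn2020, (8.4)] -/
def lineQuotπ : freeModule (total M b φ) J ⟶ lineBundle M b φ :=
  (pullbackFreeIso (toGr M b φ) J).inv ≫ (Scheme.Modules.pullback (toGr M b φ)).map (universalQuotientπ 1 M b)

/-- `𝒪_{𝐏(G)}^{(J)} ⟶ L` is an epimorphism (pull-back is a left adjoint). [cite: Hartshorne1977, II §7 Prop. 7.11 (b)] -/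
theorem epi_lineQuotπ : Epi (lineQuotπ M b φ) := by
  haveI := epi_universalQuotientπ 1 M b
  haveI : Epi ((Scheme.Modules.pullback (toGr M b φ)).map (universalQuotientπ 1 M b)) :=
    (Scheme.Modules.pullback (toGr M b φ)).map_epi _
  exact epi_comp _ _

variable [Fintype J] [Epi φ]

/-- **`u_φ` dies on `𝐏(G) = V(u_φ)`**: `ι^* u_φ = 0` (the universal property of the vanishing locus,
★ `Modules/VanishingLocusOfHom.pullback_subschemeι_map_eq_zero`; hypotheses: `pr₁^* ker φ` is affine-localizing — a
vector bundle, `G` being one — and `pr₂^*𝒬` is a vector bundle). [cite: Fulton1998, B.3.2 and B.3.4] -/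
theorem pullback_totalι_incidence_eq_zero (hG : IsFiniteLocallyFree G) :
    (Scheme.Modules.pullback (totalι M b φ)).map (incidence M b φ) = 0 := by
  have hK : IsFiniteLocallyFree (kernel φ) :=
    isFiniteLocallyFree_kernel φ (HasRank.isFiniteLocallyFree' (hasRank_freeModule X J)) hG
  have hV : IsFiniteLocallyFree ((Scheme.Modules.pullback
      (prod.snd : X ⨯ grassmannianScheme M 1 ⟶ grassmannianScheme M 1)).obj (universalQuotient 1 M b)) :=
    HasRank.isFiniteLocallyFree' (hasRank_pullback _ (hasRank_universalQuotient 1 M b))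
  exact pullback_subschemeι_map_eq_zero (incidence M b φ) (frameSystemOfIsFiniteLocallyFree hV)
    (isAffineLocalizing_of_isFiniteLocallyFree (hK.pullback _)) (isAffineLocalizing_dual_of_isFiniteLocallyFree hV)

/-- **THE INCIDENCE RELATION on `𝐏(G)`**: for some isomorphism `γ : proj^*𝒪_X^{(J)} ≅ toGr^*𝒪_{Gr}^{(J)}` (the
pseudofunctor and free-module identifications), `proj^*(ker φ ↪ 𝒪^{(J)}) ≫ γ ≫ toGr^*π = 0` — the pulled-back universal
rank-one quotient kills the pulled-back relations of `G` (`ι^* u_φ = 0` transported along `ι^* pr₁^* ≅ proj^*`,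
`ι^* pr₂^* ≅ toGr^*`, Mathlib `Scheme.Modules.pullbackComp`). [cite: Hartshorne1977, II §7 Prop. 7.12] [cite: Fulton1998, B.3.4] -/
theorem exists_pullback_kernel_ι_comp_eq_zero (hG : IsFiniteLocallyFree G) :
    ∃ γ : (Scheme.Modules.pullback (proj M b φ)).obj (freeModule X J) ≅
        (Scheme.Modules.pullback (toGr M b φ)).obj (freeModule (grassmannianScheme M 1) J),
      (Scheme.Modules.pullback (proj M b φ)).map (kernel.ι φ) ≫ γ.hom ≫
        (Scheme.Modules.pullback (toGr M b φ)).map (universalQuotientπ 1 M b) = 0 := by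
  -- the pseudofunctor isomorphisms `ι^* pr^* ≅ (ι ≫ pr)^*`, as OBJECT-level isomorphisms with their naturality
  -- squares (only their types are used below)
  obtain ⟨d₁K, d₁F, n₁⟩ : ∃ (d₁K : (Scheme.Modules.pullback (totalι M b φ)).obj
      ((Scheme.Modules.pullback (prod.fst : X ⨯ grassmannianScheme M 1 ⟶ X)).obj (kernel φ)) ≅
      (Scheme.Modules.pullback (proj M b φ)).obj (kernel φ))
      (d₁F : (Scheme.Modules.pullback (totalι M b φ)).obj
        ((Scheme.Modules.pullback (prod.fst : X ⨯ grassmannianScheme M 1 ⟶ X)).obj (freeModule X J)) ≅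
        (Scheme.Modules.pullback (proj M b φ)).obj (freeModule X J)),
      d₁K.hom ≫ (Scheme.Modules.pullback (proj M b φ)).map (kernel.ι φ) =
        (Scheme.Modules.pullback (totalι M b φ)).map ((Scheme.Modules.pullback prod.fst).map (kernel.ι φ)) ≫ d₁F.hom :=
    ⟨(Scheme.Modules.pullbackComp (totalι M b φ) prod.fst).app (kernel φ),
      (Scheme.Modules.pullbackComp (totalι M b φ) prod.fst).app (freeModule X J),
      ((Scheme.Modules.pullbackComp (totalι M b φ) prod.fst).hom.naturality (kernel.ι φ)).symm⟩
  obtain ⟨d₂F, d₂Q, n₂⟩ : ∃ (d₂F : (Scheme.Modules.pullback (totalι M b φ)).obj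
      ((Scheme.Modules.pullback (prod.snd : X ⨯ grassmannianScheme M 1 ⟶ grassmannianScheme M 1)).obj
        (freeModule (grassmannianScheme M 1) J)) ≅
      (Scheme.Modules.pullback (toGr M b φ)).obj (freeModule (grassmannianScheme M 1) J))
      (d₂Q : (Scheme.Modules.pullback (totalι M b φ)).obj
        ((Scheme.Modules.pullback (prod.snd : X ⨯ grassmannianScheme M 1 ⟶ grassmannianScheme M 1)).obj
          (universalQuotient 1 M b)) ≅ lineBundle M b φ),
      d₂F.hom ≫ (Scheme.Modules.pullback (toGr M b φ)).map (universalQuotientπ 1 M b) =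
        (Scheme.Modules.pullback (totalι M b φ)).map
          ((Scheme.Modules.pullback prod.snd).map (universalQuotientπ 1 M b)) ≫ d₂Q.hom :=
    ⟨(Scheme.Modules.pullbackComp (totalι M b φ) prod.snd).app (freeModule _ J),
      (Scheme.Modules.pullbackComp (totalι M b φ) prod.snd).app (universalQuotient 1 M b),
      ((Scheme.Modules.pullbackComp (totalι M b φ) prod.snd).hom.naturality (universalQuotientπ 1 M b)).symm⟩
  refine ⟨d₁F.symm ≪≫
    (Scheme.Modules.pullback (totalι M b φ)).mapIso (pullbackFreeIso prod.fst J ≪≫ (pullbackFreeIso prod.snd J).symm) ≪≫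
      d₂F, ?_⟩
  have h0 := pullback_totalι_incidence_eq_zero M b φ hG
  unfold incidence at h0
  simp only [Functor.map_comp] at h0
  rw [← cancel_epi d₁K.hom, comp_zero, reassoc_of% n₁]
  simp only [Iso.trans_hom, Iso.symm_hom, Functor.mapIso_hom, Functor.map_comp, Category.assoc,
    Iso.hom_inv_id_assoc]
  rw [n₂, reassoc_of% h0, zero_comp]

/-- **THE TAUTOLOGICAL QUOTIENT `λ : proj^*G ↠ L`** exists: an EPIMORPHISM `proj^*G ⟶ lineBundle` through which the
pulled-back universal quotient factors — `proj^*φ ≫ λ = γ ≫ toGr^*π` for the isomorphism `γ` of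
`exists_pullback_kernel_ι_comp_eq_zero` (`proj^*` is right exact, so `proj^*G = coker(proj^*(ker φ ↪ 𝒪^{(J)}))`; Hartshorne:
«the surjection `π^*ℰ → 𝒪(1)`»). [cite: Hartshorne1977, II §7 Prop. 7.11 (b)] [cite: Fulton1998, B.5.5] -/
theorem exists_epi_tautQuot (hG : IsFiniteLocallyFree G) :
    ∃ (lam : (Scheme.Modules.pullback (proj M b φ)).obj G ⟶ lineBundle M b φ)
      (γ : (Scheme.Modules.pullback (proj M b φ)).obj (freeModule X J) ≅
        (Scheme.Modules.pullback (toGr M b φ)).obj (freeModule (grassmannianScheme M 1) J)),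
      Epi lam ∧ (Scheme.Modules.pullback (proj M b φ)).map φ ≫ lam =
        γ.hom ≫ (Scheme.Modules.pullback (toGr M b φ)).map (universalQuotientπ 1 M b) := by
  obtain ⟨γ, hγ⟩ := exists_pullback_kernel_ι_comp_eq_zero M b φ hG
  haveI := epi_universalQuotientπ 1 M b
  -- `G = coker (ker φ ↪ 𝒪^{(J)})`, and the left adjoint `proj^*` preserves this cokernel
  have hc := Abelian.epiIsCokernelOfKernel (KernelFork.ofι (kernel.ι φ) (kernel.condition φ)) (kernelIsKernel φ)
  haveI := (Scheme.Modules.pullbackPushforwardAdjunction (proj M b φ)).leftAdjoint_preservesColimits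
  have hc' := isColimitCoforkMapOfIsColimit (Scheme.Modules.pullback (proj M b φ))
    (show kernel.ι φ ≫ φ = 0 ≫ φ by rw [zero_comp]; exact kernel.condition φ) hc
  have w : (Scheme.Modules.pullback (proj M b φ)).map (kernel.ι φ) ≫
      (γ.hom ≫ (Scheme.Modules.pullback (toGr M b φ)).map (universalQuotientπ 1 M b)) =
      (Scheme.Modules.pullback (proj M b φ)).map 0 ≫
        (γ.hom ≫ (Scheme.Modules.pullback (toGr M b φ)).map (universalQuotientπ 1 M b)) := by
    rw [hγ, Functor.map_zero, zero_comp]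
  obtain ⟨l, hl⟩ := Cofork.IsColimit.desc' hc' _ w
  rw [Cofork.π_ofπ] at hl
  haveI : Epi ((Scheme.Modules.pullback (toGr M b φ)).map (universalQuotientπ 1 M b)) :=
    (Scheme.Modules.pullback (toGr M b φ)).map_epi _
  haveI : Epi (γ.hom ≫ (Scheme.Modules.pullback (toGr M b φ)).map (universalQuotientπ 1 M b)) := epi_comp _ _
  exact ⟨l, γ, epi_of_epi_fac hl, hl⟩

/-- **THE TAUTOLOGICAL EXACT SEQUENCE `0 → K → proj^*G → L → 0` on `𝐏(G)`** for `G` of rank `r + 1`: `L` the tautological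
line bundle (rank `1`), `K = ker λ` of rank `r` (★ `Modules/KernelOfEpiHasRank.hasRank_kernel_of_epi`), middle term `proj^*G`.
[cite: Fulton1998, B.5.5 (tautological exact sequence on P(E))] [cite: Hartshorne1977, II §7 Prop. 7.11 (b)] -/
theorem exists_shortExact_of_hasRank {r : ℕ} (hG : HasRank G (r + 1)) :
    ∃ S : ShortComplex (total M b φ).Modules, S.ShortExact ∧ HasRank S.X₁ r ∧ HasRank S.X₃ 1 ∧
      Nonempty (S.X₂ ≅ (Scheme.Modules.pullback (proj M b φ)).obj G) := by
  obtain ⟨lam, γ, hlam, -⟩ := exists_epi_tautQuot M b φ (HasRank.isFiniteLocallyFree' hG)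
  haveI := hlam
  let S : ShortComplex (total M b φ).Modules := ShortComplex.mk (kernel.ι lam) lam (kernel.condition lam)
  have hS : S.ShortExact :=
    ShortComplex.ShortExact.mk' (ShortComplex.exact_of_f_is_kernel S (kernelIsKernel lam)) inferInstance hlam
  refine ⟨S, hS, ?_, hasRank_lineBundle M b φ, ⟨Iso.refl _⟩⟩
  simpa using hasRank_kernel_of_epi lam (hasRank_pullback (proj M b φ) hG) (hasRank_lineBundle M b φ)

end Tautological

end ProjBundle

end Literature.AlgebraicGeometry.Motives.Grassmannian

end
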